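import Mathlib.Analysis.Convex.SimplicialComplex.Basic
import Literature.Analysis.Convexity.BarycentricSubdivision
import HarnessLib

/-!
# Links, closed stars and antistars of a geometric simplicial complex; subdivisions

Topic `Literature/Topology/FourManifolds`; definition request `defn-StellarMoves` (D1 of route
`SmoothPoincare4/LogCYSkeleton`), geometric part: the subcomplexes of Mathlib's
`Geometry.SimplicialComplex 𝕜 E` that the PL plumbing of `CertificateRecognition`
(`stmt-SmoothPoincare4-13646`: `|K| = |st v| ∪ |ast v|`, `|st v| ∩ |ast v| = |lk v|`) and the
subdivision clause of `StanleyReisnerRealisation` (`stmt-SmoothPoincare4-13644`) talk about.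

* `antistarCx K v` — the **antistar** (deletion) of a vertex: the subcomplex of simplices not
  containing `v`, faces `{s ∈ K.faces | v ∉ s}` (the route clause; definitionally
  `Faces.antistar K.faces v` of `StellarMoves.lean`);
* `closedStarCx K A` — the **closed star** `st(A,K) = A ⋆ lk(A,K)`: faces `s` with `s ∪ A ∈ K`;
* `linkCx K A` — the **link** `lk(A,K) = {B ∈ K : A ⋆ B ∈ K}`: faces disjoint from `A` with
  `s ∪ A ∈ K` [Lickorish1999, §2]; (Datta 2007, §1);
* `IsSubdivision K K'` — `K'` **subdivides** `K`: `|K'| = |K|` and each simplex of `K'` lies in a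
  simplex of `K` [Lickorish1999, §2]; VERBATIM the clause
  `K'.space = K.space ∧ ∀ s' ∈ K'.faces, ∃ s ∈ K.faces, convexHull ℝ ↑s' ⊆ convexHull ℝ ↑s` inlined in
  `stmt-SmoothPoincare4-13644` (which adds `K'.faces.Finite` in front).

Proved: the three are subcomplexes (`_le`), `lk ≤ st`, `lk ≤ ast` (vertex case);
**`|st(v)| ∪ |ast(v)| = |K|`** (`space_closedStarCx_union_space_antistarCx`) and
**`|st(v)| ∩ |ast(v)| = |lk(v)|`** (`space_closedStarCx_inter_space_antistarCx`, from the
intersection axiom of a geometric complex); `IsSubdivision` is reflexive and transitive, and the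
first derived subdivision `Literature.Analysis.Convexity.sd K` is a subdivision (`isSubdivision_sd`,
non-vacuity).  No named facts are introduced.

Not here: the combinatorics of stellar moves (`StellarMoves.lean`, on `K.faces`); PL
homeomorphisms of complexes and the classical theorems (companion facts file); regular
neighbourhoods.

## References

* W. B. R. Lickorish, *Simplicial moves on complexes and manifolds*, Geom. Topol. Monogr. 2 (1999)
  299–320, §2 (link, star, subdivision). [Lickorish1999]
* B. Datta, *Minimal triangulations of manifolds*, J. Indian Inst. Sci. 87 (2007), §1 (stars,
  links, subdivisions `L ◁ K`). [Datta2007]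
-/

open Set

noncomputable section

namespace Literature.Topology.FourManifolds

/-! ### Antistar, closed star and link as subcomplexes -/

section Subcomplexes

variable {𝕜 E : Type*} [Ring 𝕜] [PartialOrder 𝕜] [AddCommGroup E] [Module 𝕜 E]

/-- **Antistar** (deletion) of a vertex `v` in the geometric complex `K`: the subcomplex of the
simplices not containing `v` — the closed complement of the open star of `v`.  Its faces are
literally `{s ∈ K.faces | v ∉ s}`, the clause of route `SmoothPoincare4/LogCYSkeleton`.
[cite: Datta2007, §1 (stars and links; induced subcomplexes)] -/
def antistarCx (K : Geometry.SimplicialComplex 𝕜 E) (v : E) : Geometry.SimplicialComplex 𝕜 E where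
  faces := {s ∈ K.faces | v ∉ s}
  isRelLowerSet_faces := fun _ hs =>
    ⟨(K.isRelLowerSet_faces hs.1).1, fun _ hts ht => ⟨K.down_closed hs.1 hts ht, fun hv => hs.2 (hts hv)⟩⟩
  indep hs := K.indep hs.1
  inter_subset_convexHull hs ht := K.inter_subset_convexHull hs.1 ht.1

/-- The faces of the antistar (definitional). [folklore] -/
@[simp] theorem antistarCx_faces (K : Geometry.SimplicialComplex 𝕜 E) (v : E) :
    (antistarCx K v).faces = {s ∈ K.faces | v ∉ s} := rfl

/-- The antistar is a subcomplex. [folklore] -/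
theorem antistarCx_le (K : Geometry.SimplicialComplex 𝕜 E) (v : E) : antistarCx K v ≤ K :=
  fun _ hs => hs.1

variable [DecidableEq E]

/-- **Closed star** of a face `A` in `K`: the subcomplex of the faces `s` with `s ∪ A ∈ K` (all faces
of the simplices containing `A`), `st(A,K) = A ⋆ lk(A,K)`. [cite: Lickorish1999, §2 (link and closed star)] -/
def closedStarCx (K : Geometry.SimplicialComplex 𝕜 E) (A : Finset E) : Geometry.SimplicialComplex 𝕜 E where
  faces := {s ∈ K.faces | s ∪ A ∈ K.faces}
  isRelLowerSet_faces := fun _ hs =>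
    ⟨(K.isRelLowerSet_faces hs.1).1, fun _ hts ht => ⟨K.down_closed hs.1 hts ht,
      K.down_closed hs.2 (Finset.union_subset_union hts Finset.Subset.rfl) (ht.mono Finset.subset_union_left)⟩⟩
  indep hs := K.indep hs.1
  inter_subset_convexHull hs ht := K.inter_subset_convexHull hs.1 ht.1

/-- **Link** of a face `A` in `K`: the subcomplex of the faces `s` disjoint from `A` with
`s ∪ A ∈ K`, `lk(A,K) = {B ∈ K : A ⋆ B ∈ K}`. [cite: Lickorish1999, §2 (link and closed star)] -/
def linkCx (K : Geometry.SimplicialComplex 𝕜 E) (A : Finset E) : Geometry.SimplicialComplex 𝕜 E where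
  faces := {s ∈ K.faces | Disjoint s A ∧ s ∪ A ∈ K.faces}
  isRelLowerSet_faces := fun _ hs =>
    ⟨(K.isRelLowerSet_faces hs.1).1, fun _ hts ht => ⟨K.down_closed hs.1 hts ht, hs.2.1.mono_left hts,
      K.down_closed hs.2.2 (Finset.union_subset_union hts Finset.Subset.rfl) (ht.mono Finset.subset_union_left)⟩⟩
  indep hs := K.indep hs.1
  inter_subset_convexHull hs ht := K.inter_subset_convexHull hs.1 ht.1

/-- The faces of the closed star (definitional). [folklore] -/
@[simp] theorem closedStarCx_faces (K : Geometry.SimplicialComplex 𝕜 E) (A : Finset E) :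
    (closedStarCx K A).faces = {s ∈ K.faces | s ∪ A ∈ K.faces} := rfl

/-- The faces of the link (definitional). [folklore] -/
@[simp] theorem linkCx_faces (K : Geometry.SimplicialComplex 𝕜 E) (A : Finset E) :
    (linkCx K A).faces = {s ∈ K.faces | Disjoint s A ∧ s ∪ A ∈ K.faces} := rfl

/-- The closed star is a subcomplex. [folklore] -/
theorem closedStarCx_le (K : Geometry.SimplicialComplex 𝕜 E) (A : Finset E) : closedStarCx K A ≤ K :=
  fun _ hs => hs.1

/-- The link is a subcomplex of the closed star. [folklore] -/
theorem linkCx_le_closedStarCx (K : Geometry.SimplicialComplex 𝕜 E) (A : Finset E) :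
    linkCx K A ≤ closedStarCx K A :=
  fun _ hs => ⟨hs.1, hs.2.2⟩

/-- The link is a subcomplex. [folklore] -/
theorem linkCx_le (K : Geometry.SimplicialComplex 𝕜 E) (A : Finset E) : linkCx K A ≤ K :=
  fun _ hs => hs.1

/-- The link of a vertex lies in its antistar. [folklore] -/
theorem linkCx_singleton_le_antistarCx (K : Geometry.SimplicialComplex 𝕜 E) (v : E) :
    linkCx K {v} ≤ antistarCx K v :=
  fun _ hs => ⟨hs.1, Finset.disjoint_singleton_right.1 hs.2.1⟩

/-- A simplex through `v` lies in the closed star of `v`. [folklore] -/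
theorem mem_closedStarCx_faces_of_mem {K : Geometry.SimplicialComplex 𝕜 E} {v : E} {s : Finset E}
    (hs : s ∈ K.faces) (hv : v ∈ s) : s ∈ (closedStarCx K {v}).faces :=
  ⟨hs, by rwa [Finset.union_eq_left.2 (Finset.singleton_subset_iff.2 hv)]⟩

/-- The faces of `K` are those of the closed star of `v` together with those of the antistar.
[folklore] -/
theorem closedStarCx_faces_union_antistarCx_faces (K : Geometry.SimplicialComplex 𝕜 E) (v : E) :
    (closedStarCx K {v}).faces ∪ (antistarCx K v).faces = K.faces := by
  refine Set.Subset.antisymm (Set.union_subset (closedStarCx_le K _) (antistarCx_le K v)) fun s hs => ?_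
  by_cases hv : v ∈ s
  · exact Or.inl (mem_closedStarCx_faces_of_mem hs hv)
  · exact Or.inr ⟨hs, hv⟩

/-- The faces common to the closed star and the antistar of `v` are those of the link. [folklore] -/
theorem closedStarCx_faces_inter_antistarCx_faces (K : Geometry.SimplicialComplex 𝕜 E) (v : E) :
    (closedStarCx K {v}).faces ∩ (antistarCx K v).faces = (linkCx K {v}).faces := by
  ext s
  simp only [Set.mem_inter_iff, closedStarCx_faces, antistarCx_faces, linkCx_faces, Set.mem_setOf_eq,
    Finset.disjoint_singleton_right]
  tauto

/-- **`|K| = |st(v)| ∪ |ast(v)|`**: the polyhedron is the union of the closed star of a vertex and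
its antistar. [folklore] -/
theorem space_closedStarCx_union_space_antistarCx (K : Geometry.SimplicialComplex 𝕜 E) (v : E) :
    (closedStarCx K {v}).space ∪ (antistarCx K v).space = K.space := by
  refine Set.Subset.antisymm ?_ fun x hx => ?_
  · rintro x (hx | hx)
    · obtain ⟨s, hs, hxs⟩ := Geometry.SimplicialComplex.mem_space_iff.1 hx
      exact K.convexHull_subset_space hs.1 hxs
    · obtain ⟨s, hs, hxs⟩ := Geometry.SimplicialComplex.mem_space_iff.1 hx
      exact K.convexHull_subset_space hs.1 hxs
  · obtain ⟨s, hs, hxs⟩ := Geometry.SimplicialComplex.mem_space_iff.1 hx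
    rw [← closedStarCx_faces_union_antistarCx_faces K v] at hs
    rcases hs with hs | hs
    · exact Or.inl ((closedStarCx K {v}).convexHull_subset_space hs hxs)
    · exact Or.inr ((antistarCx K v).convexHull_subset_space hs hxs)

/-- **`|st(v)| ∩ |ast(v)| = |lk(v)|`**: the closed star of a vertex meets the antistar exactly in
the link (two closed simplices of a geometric complex meet in their common face). [folklore] -/
theorem space_closedStarCx_inter_space_antistarCx (K : Geometry.SimplicialComplex 𝕜 E) (v : E) :
    (closedStarCx K {v}).space ∩ (antistarCx K v).space = (linkCx K {v}).space := by
  refine Set.Subset.antisymm ?_ fun x hx => ?_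
  · rintro x ⟨hx₁, hx₂⟩
    obtain ⟨s, hs, hxs⟩ := Geometry.SimplicialComplex.mem_space_iff.1 hx₁
    obtain ⟨t, ht, hxt⟩ := Geometry.SimplicialComplex.mem_space_iff.1 hx₂
    -- the two closed simplices meet in the closed simplex of `s ∩ t`, a face of the link
    have hxi : x ∈ convexHull 𝕜 (↑(s ∩ t) : Set E) := by
      rw [Finset.coe_inter]
      exact K.inter_subset_convexHull hs.1 ht.1 ⟨hxs, hxt⟩
    have hne : (s ∩ t).Nonempty := by
      by_contra h0
      rw [Finset.not_nonempty_iff_eq_empty] at h0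
      rw [h0, Finset.coe_empty, convexHull_empty] at hxi
      exact hxi
    refine (linkCx K {v}).convexHull_subset_space ⟨K.down_closed hs.1 Finset.inter_subset_left hne, ?_, ?_⟩ hxi
    · exact Finset.disjoint_singleton_right.2 fun h => ht.2 (Finset.mem_inter.1 h).2
    · exact K.down_closed hs.2 (Finset.union_subset_union Finset.inter_subset_left Finset.Subset.rfl)
        (hne.mono Finset.subset_union_left)
  · obtain ⟨s, hs, hxs⟩ := Geometry.SimplicialComplex.mem_space_iff.1 hx
    exact ⟨(closedStarCx K {v}).convexHull_subset_space (linkCx_le_closedStarCx K _ hs) hxs,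
      (antistarCx K v).convexHull_subset_space (linkCx_singleton_le_antistarCx K v hs) hxs⟩

/-- The link of a vertex misses the vertex. [folklore] -/
theorem notMem_of_mem_linkCx_faces {K : Geometry.SimplicialComplex 𝕜 E} {v : E} {s : Finset E}
    (hs : s ∈ (linkCx K {v}).faces) : v ∉ s :=
  Finset.disjoint_singleton_right.1 hs.2.1

/-- A finite complex has finite closed stars. [folklore] -/
theorem closedStarCx_finite {K : Geometry.SimplicialComplex 𝕜 E} (hK : K.faces.Finite) (A : Finset E) :
    (closedStarCx K A).faces.Finite :=
  hK.subset (closedStarCx_le K A)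

/-- A finite complex has finite links. [folklore] -/
theorem linkCx_finite {K : Geometry.SimplicialComplex 𝕜 E} (hK : K.faces.Finite) (A : Finset E) :
    (linkCx K A).faces.Finite :=
  hK.subset (linkCx_le K A)

omit [DecidableEq E] in
/-- A finite complex has finite antistars. [folklore] -/
theorem antistarCx_finite {K : Geometry.SimplicialComplex 𝕜 E} (hK : K.faces.Finite) (v : E) :
    (antistarCx K v).faces.Finite :=
  hK.subset (antistarCx_le K v)

end Subcomplexes

/-! ### Subdivisions -/

section Subdivision

variable {𝕜 E : Type*} [Ring 𝕜] [PartialOrder 𝕜] [AddCommGroup E] [Module 𝕜 E]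

/-- **`K'` is a subdivision of `K`**: the two complexes have the same underlying space and every
simplex of `K'` is contained in a simplex of `K` ("`|K'| = |K|` and each simplex of `K'` is
contained linearly in some simplex of `K`" [cite: Lickorish1999, §2 (subdivision)]; Datta (2007), §1,
`L ◁ K`).  Verbatim the clause inlined in route item `stmt-SmoothPoincare4-13644`. -/
def IsSubdivision (K K' : Geometry.SimplicialComplex 𝕜 E) : Prop :=
  K'.space = K.space ∧
    ∀ s' ∈ K'.faces, ∃ s ∈ K.faces, convexHull 𝕜 (s' : Set E) ⊆ convexHull 𝕜 (s : Set E)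

/-- Unfolding of `IsSubdivision` (it is the route clause). [folklore] -/
theorem isSubdivision_iff (K K' : Geometry.SimplicialComplex 𝕜 E) :
    IsSubdivision K K' ↔ K'.space = K.space ∧
      ∀ s' ∈ K'.faces, ∃ s ∈ K.faces, convexHull 𝕜 (s' : Set E) ⊆ convexHull 𝕜 (s : Set E) :=
  Iff.rfl

/-- Every complex subdivides itself. [folklore] -/
theorem IsSubdivision.refl (K : Geometry.SimplicialComplex 𝕜 E) : IsSubdivision K K :=
  ⟨rfl, fun s hs => ⟨s, hs, Subset.rfl⟩⟩

/-- A subdivision of a subdivision is a subdivision. [folklore] -/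
theorem IsSubdivision.trans {K K' K'' : Geometry.SimplicialComplex 𝕜 E} (h₁ : IsSubdivision K K')
    (h₂ : IsSubdivision K' K'') : IsSubdivision K K'' := by
  refine ⟨h₂.1.trans h₁.1, fun s'' hs'' => ?_⟩
  obtain ⟨s', hs', h'⟩ := h₂.2 s'' hs''
  obtain ⟨s, hs, h⟩ := h₁.2 s' hs'
  exact ⟨s, hs, h'.trans h⟩

/-- A subdivision has the same underlying space. [folklore] -/
theorem IsSubdivision.space_eq {K K' : Geometry.SimplicialComplex 𝕜 E} (h : IsSubdivision K K') :
    K'.space = K.space :=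
  h.1

/-- Each simplex of a subdivision lies in a simplex of the complex. [folklore] -/
theorem IsSubdivision.exists_subset {K K' : Geometry.SimplicialComplex 𝕜 E} (h : IsSubdivision K K')
    {s' : Finset E} (hs' : s' ∈ K'.faces) :
    ∃ s ∈ K.faces, convexHull 𝕜 (s' : Set E) ⊆ convexHull 𝕜 (s : Set E) :=
  h.2 s' hs'

end Subdivision

/-- **The first derived subdivision is a subdivision**: Mathlib-level non-vacuity of
`IsSubdivision`, from `Literature.Analysis.Convexity.space_sd` and
`Literature.Analysis.Convexity.convexHull_subset_of_mem_sd` (Rourke–Sanderson 1972, Ch. 2).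
[folklore] -/
theorem isSubdivision_sd {E : Type*} [AddCommGroup E] [Module ℝ E] [DecidableEq E]
    (K : Geometry.SimplicialComplex ℝ E) : IsSubdivision K (Literature.Analysis.Convexity.sd K) := by
  refine ⟨Literature.Analysis.Convexity.space_sd K, fun σ hσ => ?_⟩
  obtain ⟨F, hF, -, h⟩ := Literature.Analysis.Convexity.convexHull_subset_of_mem_sd hσ
  exact ⟨F, hF, h⟩

end Literature.Topology.FourManifolds

end
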